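import Summits.BirchSwinnertonDyer.BirchSwinnertonDyer.Theorems.GenusKolyvaginAtTwoGenusDeepSupplyAtTwoNegDiscNarrowOfKernelsPrime
import Summits.BirchSwinnertonDyer.BirchSwinnertonDyer.Theorems.GenusKolyvaginAtTwoK4NegOfWallRowsU2AlphaOrNonPhantom
import Summits.BirchSwinnertonDyer.BirchSwinnertonDyer.Theorems.GenusKolyvaginAtTwoK4NegPhantomCellDescentBitFrames
import HarnessLib

/-!
# Route `GenusKolyvaginAtTwo`, crux 23491 `GenusDeepSupplyAtTwoNegDiscNarrow` BY NAME ⟸ K₁ + WALL row 1 + U₂ + Q2 + PRINT + the five supply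
# items — WITHOUT the beyond-print kernel K₄⁻ (`K4Neg`)

LEAD seat `bsd-line-gk2-p1` g29, `--supports stmt-BirchSwinnertonDyer-23491 --as helper`.  THEOREMS ONLY; no `sorry`; standard axioms.
**BSD is NOT proved here; crux 23491 is NOT closed (every hypothesis below is an OPEN route item or a PRINT item, taken BY NAME); K4Neg is NOT
proved.**  What this file shows is that K4Neg (stmt-31526) is no longer an input of the Δ<0 supply crux: the `∃K`-supply may CHOOSE its frame.

THE DICHOTOMY (per habitat curve `E = W/ℚ`, `Δ < 0`, `#Sel₂(E) ∈ {1, 4}`).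
* `#Sel₂(E) = 4` and every level-4 phantom (non-zero `ξ ∈ H¹(ℚ, E[2])` dying on `Γ_{ℚ(E[4])}`, Lawson–Wuthrich) is a `2`-Selmer class
  (the phantom cell F4ᵖᵍ): frame `E` at an (α)-PRIME — gk2-p3 g34's UNCONDITIONAL supply `PhantomDescentBit.exists_alive_primeFrame_of_phantom_selmer`
  (prime Heegner field `K = ℚ(√−ℓ)`, every field clause of the crux, `2` split, `Sel₂`-minimal twin, AND the (α) Galois datum `[ξ, F·F] ≠ 0`);
  the twin is non-CM, has analytic rank `1` (Modularity + 2-parity + the two 2-converse items, as in stub A‴) and genus budget one bit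
  (gk2-p2 `padicValNat_two_tamagawaProduct_twin_eq_one_of_prime`); at positive depth K₄⁻'s conclusion is
  `PlusDescent.kFourNeg_conclusion_of_wallRows_U2_of_alive` (LEAD g29, p791338) ⟸ WALL + U₂ + Q2 + PRINT.
* otherwise (`#Sel₂(E) = 1`, or some phantom is NOT Selmer — then, the phantom being UNIQUE (`Lw2PhantomExclusion` rigidity over the Heegner
  field + injectivity of `res_K`), NO phantom is Selmer): frame `E` by the standard stub A‴ (`stubA_prime_of_items`); at positive depth the
  `#Sel₂ = 1` cell is K₁ (`K1Neg` BY NAME, `… → False`) and the `#Sel₂ = 4` cell is bit-TRUE, where (NPh_K) holds and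
  `PlusDescent.kFourNeg_conclusion_of_wallRows_U2_of_forall_phantom_notMem_selmerGroup` ⟸ WALL + U₂ + Q2 + PRINT concludes.
Depth zero is free (`exists_deepWitness_of_depth_zero`); `y_K` is non-torsion by Gross–Zagier; `M₀` is McCallum's exponent.

* §1 `forall_phantom_notMem_selmerGroup_of_exists` — uniqueness of the phantom turns «some phantom is not Selmer» into «no phantom is Selmer».
* §2 `genusDeepSupply_conclusion_of_frame` — the crux's conclusion AT ONE CURVE from a prime frame + a positive-depth engine at that frame.
* §3 ★★ `genusDeepSupplyAtTwoNegDiscNarrow_of_K1Neg_of_wallRows_U2` — **crux 23491 BY NAME ⟸ GZ ∧ Mod ∧ Par ∧ Conv ∧ Conv′ ∧ K1Neg ∧ the four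
  WALL rows ∧ U₂ ∧ Q2 ∧ GZK ∧ L ∧ Milne** (fourteen displayed hypotheses, all route/PRINT items by name; NO K4Neg).

References: [GrossZagier1986] Thm. I.6.3, V.§2; [GrossLMS1991] §3 (3.5), §4 (4.1), §9, §11; [McCallumLMS1991] §5 Thm. 5.4; [MazurRubin2010]
Prop. 3.3, Cor. 3.4 (i); [LawsonWuthrich2016] §3, §7.1; [Kolyvagin1989Izv] Thm. B₂; [WZhang2014] Thm. 1.1 (p ≥ 5; here p = 2 on chosen frames).
-/

set_option autoImplicit false
set_option linter.dupNamespace false -- `Summit.<P>.<Sub>` repeats `BirchSwinnertonDyer` (D-0017)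

noncomputable section

open scoped Classical

namespace Summit.BirchSwinnertonDyer.BirchSwinnertonDyer.Theorems.GenusSupplyNarrow.PrimeFrame

open WeierstrassCurve NumberField IsDedekindDomain Field Rat.HeightOneSpectrum
  Literature.NumberTheory.EllipticCurves Literature.NumberTheory.EllipticCurves.ModularForms
  Literature.NumberTheory.GaloisRepresentations
  Summit.BirchSwinnertonDyer.BirchSwinnertonDyer.Theses.GenusKolyvaginAtTwo
  Summit.BirchSwinnertonDyer.BirchSwinnertonDyer.Theorems.GenusKoly
  Summit.BirchSwinnertonDyer.BirchSwinnertonDyer.Theorems.GenusSupplyNarrow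
open Summit.BirchSwinnertonDyer.BirchSwinnertonDyer.Theses.ByReductionTypeAtTwo
  (GoodOrdinaryRankZeroAtTwo MultiplicativeRankZeroAtTwo SupersingularRankZeroAtTwo AdditiveRankZeroAtTwo)
open Summit.BirchSwinnertonDyer.BirchSwinnertonDyer.Theorems.GenusExact

/-! ## §1 Uniqueness of the phantom: «some phantom is not Selmer» ⟹ «no phantom is Selmer» -/

/-- **The level-4 phantom is unique**, read on `Sel₂(E/ℚ)`: frame `ρ_{E,2^n}` onto, `K` imaginary quadratic with odd `d_K` and the two
Theorem-B₂ non-squares.  If SOME non-zero `ξ₀ ∈ H¹(ℚ, E[2])` dying on `Γ_{ℚ(E[4])}` lies outside `Sel₂(E/ℚ)`, then EVERY such class does: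
for another one `x`, `res_K x` is non-zero and dies on `Γ_{K(E[4])}`, so `res_K x = res_K ξ₀` (LEAD g26's rigidity
`Lw2PhantomExclusion.eq_zero_or_eq_resTorsion_of_forall_torsionFixing_pow`), and `res_K` is injective (`E(K)[2] = 0`), so `x = ξ₀`.
[cite: LawsonWuthrich2016, §3 (Lemma 6, Thm. 1), §7.1] [cite: SerreGaloisCohomology1997, I.§2.6 (b)] -/
theorem forall_phantom_notMem_selmerGroup_of_exists (W : WeierstrassCurve ℚ) [W.IsElliptic]
    (hρ : ∀ n : ℕ, 0 < n → W.HasSurjectiveModNGaloisRep ((2 : ℤ) ^ n))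
    (K : Type) [Field K] [NumberField K] (hIQ : IsImaginaryQuadratic K) (hodd : Odd (NumberField.discr K))
    (hsq1 : ¬ IsSquare ((NumberField.discr K : ℚ) * -|W.Δ|)) (hsq2 : ¬ IsSquare ((NumberField.discr K : ℚ) * (-(2 * |W.Δ|))))
    {ξ₀ : galH1Torsion W (2 : ℤ)} (hξ0 : ξ₀ ≠ 0) (hξ4 : ∀ h ∈ torsionFixing W (4 : ℤ), h1Eval W (2 : ℤ) ξ₀ h = 0)
    (hξS : ξ₀ ∉ selmerGroup W (2 : ℤ)) :
    ∀ x : galH1Torsion W (2 : ℤ), x ≠ 0 → (∀ h ∈ torsionFixing W (4 : ℤ), h1Eval W (2 : ℤ) x h = 0) → x ∉ selmerGroup W (2 : ℤ) := by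
  intro x hx0 hx4 hxS
  have h2 : Module.finrank ℚ K = 2 := hIQ.1
  obtain ⟨θ, hθ, hcθ⟩ := exists_sq_eq_discr_not_mem_range K h2
  have hinj := EigenClassesFinite.resTorsion_injective_of_noTorsion W K h2 hθ hcθ (2 : ℤ)
    (Lw2PhantomExclusion.forall_two_zsmul_eq_zero_baseChange W hρ hIQ)
  obtain ⟨hxK0, hxK⟩ := Lw2PhantomExclusion.resTorsion_ne_zero_and_forall_torsionFixing_four W hρ hIQ hx0 hx4
  have h4 : ((2 ^ 2 : ℕ) : ℤ) = 4 := by norm_num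
  have hz : ∀ ρ ∈ torsionFixing (W.baseChange K) ((2 ^ 2 : ℕ) : ℤ),
      h1Eval (W.baseChange K) (2 : ℤ) (resTorsion W K (2 : ℤ) x) ρ = 0 := by
    intro ρ hρ'
    have hρ4 : ρ ∈ torsionFixing (W.baseChange K) (4 : ℤ) := by rw [← h4]; exact hρ'
    exact hxK ρ hρ4
  rcases Lw2PhantomExclusion.eq_zero_or_eq_resTorsion_of_forall_torsionFixing_pow W hρ hIQ hodd hsq1 hsq2 hξ0 hξ4 (M := 2) le_rfl hz
    with h0 | heq
  · exact hxK0 h0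
  · exact hξS (hinj heq ▸ hxS)

/-! ## §2 The crux's conclusion at ONE curve from a prime frame and a positive-depth engine at that frame -/

/-- **The conclusion of `GenusDeepSupplyAtTwoNegDiscNarrow` AT ONE HABITAT CURVE, from a prime Heegner frame `(K, ℓ₀, Wd)` with every clause
and an ENGINE for positive depth at that frame** (for every orientation `β`, embedding `ι`, conductor-`1` datum `d₁` with `y_K` of infinite
order and exact exponent `M₀ ≥ 1`, the deep square-free witness).  Glue = g21/g22's composition verbatim: `β` from the Heegner hypothesis,
`ι`, `d₁` (`exists_kolyvaginHeegnerData_one`), `y_K` non-torsion from Gross–Zagier at the pair (`stub_heegnerNonTorsionAtTwo_pair_of_grossZagier`),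
McCallum's exponent, depth zero free (`exists_deepWitness_of_depth_zero`).  CONDITIONAL on GZ (route item 24148 by name) and the engine.
[cite: GrossZagier1986, Thm. I.6.3] [cite: GrossLMS1991, §3 (3.5), §4 (4.1)] -/
theorem genusDeepSupply_conclusion_of_frame (hGZ : GrossZagierAllLevels)
    (W : WeierstrassCurve ℚ) [W.IsElliptic] [W.IsGloballyMinimal] [NeZero (W.conductorNorm ℤ)]
    (hcm : ¬ W.HasCM) (hr0 : W.analyticRank = 0)
    (Dt : ModularParametrizationData W (W.conductorNorm ℤ))
    (hoptDt : ∀ z ∈ Dt.L.lattice, ∃ w ∈ periodLattice Dt.f, z = (Dt.c : ℂ) * w) (hc : Odd Dt.c)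
    (K : Type) [Field K] [NumberField K] (hIQ : IsImaginaryQuadratic K) (hodd : Odd (NumberField.discr K))
    (h3 : NumberField.discr K ≠ -3) (hHe : SatisfiesHeegnerHypothesis (W.conductorNorm ℤ) K)
    (hsq1 : ¬ IsSquare ((NumberField.discr K : ℚ) * -|W.Δ|)) (hsq2 : ¬ IsSquare ((NumberField.discr K : ℚ) * (-(2 * |W.Δ|))))
    (Wd : WeierstrassCurve ℚ) [Wd.IsElliptic] [Wd.IsGloballyMinimal]
    (hWd : ∃ C : VariableChange ℚ, C • W.quadraticTwist (NumberField.discr K : ℚ) = Wd)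
    (hrd : Wd.analyticRank = 1) (hSel : Nat.card (Wd.selmerGroup 2) = 2) (hDEF : padicValNat 2 Wd.tamagawaProduct ≤ 1)
    (hC : ∀ (β : ℤ) (ι : K →+* ℂ) (d₁ : KolyvaginHeegnerData Dt β ι 1), ¬ IsOfFinAddOrder d₁.derivedPoint →
      ∀ (M₀ : ℕ), (∃ Q : (W.baseChange (ringClassField K ι 1)).toAffine.Point, ((2 ^ M₀ : ℕ) : ℤ) • Q = d₁.derivedPoint) →
      (¬ ∃ Q : (W.baseChange (ringClassField K ι 1)).toAffine.Point, ((2 ^ (M₀ + 1) : ℕ) : ℤ) • Q = d₁.derivedPoint) →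
      1 ≤ M₀ →
      ∃ (n : ℕ) (d : KolyvaginHeegnerData Dt β ι n), Squarefree n ∧
      (∀ ℓ ∈ n.primeFactors, Zhang2014.IsKolyvaginPrime (W.conductorNorm ℤ) W K 2 ℓ ∧ 2 ≤ Zhang2014.kolyvaginIndex W 2 ℓ ∧
      FrobEqFrobInfty W K 2 ℓ) ∧
      ¬ ∃ Q : (W.baseChange (ringClassField K ι n)).toAffine.Point, (2 : ℤ) • Q = d.derivedPoint) :
    ∃ (K : Type) (_ : Field K) (_ : NumberField K),
    IsImaginaryQuadratic K ∧ Odd (NumberField.discr K) ∧ NumberField.discr K ≠ -3 ∧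
    SatisfiesHeegnerHypothesis (W.conductorNorm ℤ) K ∧
    ¬ IsSquare ((NumberField.discr K : ℚ) * -|W.Δ|) ∧ ¬ IsSquare ((NumberField.discr K : ℚ) * (-(2 * |W.Δ|))) ∧
    ∃ (Dt : ModularParametrizationData W (W.conductorNorm ℤ)) (β : ℤ) (ι : K →+* ℂ) (d₁ : KolyvaginHeegnerData Dt β ι 1),
    (∀ z ∈ Dt.L.lattice, ∃ w ∈ periodLattice Dt.f, z = (Dt.c : ℂ) * w) ∧ Odd Dt.c ∧ ¬ IsOfFinAddOrder d₁.derivedPoint ∧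
    ∃ M₀ : ℕ, (∃ Q : (W.baseChange (ringClassField K ι 1)).toAffine.Point, ((2 ^ M₀ : ℕ) : ℤ) • Q = d₁.derivedPoint) ∧
    (¬ ∃ Q : (W.baseChange (ringClassField K ι 1)).toAffine.Point, ((2 ^ (M₀ + 1) : ℕ) : ℤ) • Q = d₁.derivedPoint) ∧
    ∃ (n : ℕ) (d : KolyvaginHeegnerData Dt β ι n), Squarefree n ∧
    (∀ ℓ ∈ n.primeFactors, Zhang2014.IsKolyvaginPrime (W.conductorNorm ℤ) W K 2 ℓ ∧ 2 ≤ Zhang2014.kolyvaginIndex W 2 ℓ ∧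
    FrobEqFrobInfty W K 2 ℓ) ∧
    (¬ ∃ Q : (W.baseChange (ringClassField K ι n)).toAffine.Point, (2 : ℤ) • Q = d.derivedPoint) ∧
    ∃ (Wd : WeierstrassCurve ℚ) (_ : Wd.IsElliptic) (_ : Wd.IsGloballyMinimal),
    (∃ C : VariableChange ℚ, C • W.quadraticTwist (NumberField.discr K : ℚ) = Wd) ∧
    ¬ Wd.HasCM ∧ Wd.analyticRank = 1 ∧ Nat.card (Wd.selmerGroup 2) = 2 ∧ padicValNat 2 Wd.tamagawaProduct ≤ 1 := by
  -- glue: orientation, embedding, conductor-`1` datum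
  obtain ⟨β, hβ⟩ : ∃ β : ℤ, (4 * (W.conductorNorm ℤ : ℕ) : ℤ) ∣ β ^ 2 - NumberField.discr K :=
    Literature.NumberTheory.QuadraticFields.Quadratic.exists_dvd_sq_sub_discr_of_ncard_primesOver hIQ.1 (NeZero.ne _) hHe
  obtain ⟨ι⟩ : Nonempty (K →+* ℂ) := inferInstance
  obtain ⟨d₁⟩ := exists_kolyvaginHeegnerData_one
    (phi_heegnerTau_mem_singularModuliField_holds (W.conductorNorm ℤ) W K) hIQ Dt β ι hβ
  -- the twin: non-CM; the analytic rank of the twist is read off its minimal model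
  have hd : (NumberField.discr K : ℚ) ≠ 0 := by exact_mod_cast NumberField.discr_ne_zero K
  haveI := W.isElliptic_quadraticTwist hd
  have hcmd : ¬ Wd.HasCM := twin_not_hasCM W hcm hd Wd hWd
  have hrtw : (W.quadraticTwist (NumberField.discr K : ℚ)).analyticRank = 1 := by
    obtain ⟨C, hC⟩ := hWd
    rw [← analyticRank_smul (W.quadraticTwist (NumberField.discr K : ℚ)) C, hC]
    exact hrd
  -- `y_K` of infinite order from Gross–Zagier at the pair `(E, K)`
  have hy : ¬ IsOfFinAddOrder d₁.derivedPoint :=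
    stub_heegnerNonTorsionAtTwo_pair_of_grossZagier W K (hGZ (W.conductorNorm ℤ) W K) hIQ hHe hr0 hrtw Dt β ι d₁
  -- McCallum's exponent
  obtain ⟨M₀, hdiv, hndiv⟩ := exists_exactTwoDivisibility_of_not_isOfFinAddOrder W hIQ Dt β ι d₁ hy
  -- the deep witness: free at depth `0`, the engine at positive depth
  obtain ⟨n, d, hn, hKoly, hPn⟩ : ∃ (n : ℕ) (d : KolyvaginHeegnerData Dt β ι n), Squarefree n ∧
      (∀ ℓ ∈ n.primeFactors, Zhang2014.IsKolyvaginPrime (W.conductorNorm ℤ) W K 2 ℓ ∧ 2 ≤ Zhang2014.kolyvaginIndex W 2 ℓ ∧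
        FrobEqFrobInfty W K 2 ℓ) ∧
      ¬ ∃ Q : (W.baseChange (ringClassField K ι n)).toAffine.Point, (2 : ℤ) • Q = d.derivedPoint := by
    rcases Nat.eq_zero_or_pos M₀ with hM | hM
    · subst hM
      exact exists_deepWitness_of_depth_zero W Dt β ι d₁ _ hndiv
    · exact hC β ι d₁ hy M₀ hdiv hndiv hM
  exact ⟨K, inferInstance, inferInstance, hIQ, hodd, h3, hHe, hsq1, hsq2, Dt, β, ι, d₁, hoptDt, hc, hy, M₀, hdiv, hndiv, n, d, hn, hKoly,
    hPn, Wd, inferInstance, inferInstance, hWd, hcmd, hrd, hSel, hDEF⟩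

/-! ## §3 The crux 23491 by name, without K4Neg -/

/-- ★★ **THE Δ<0 SUPPLY CRUX `GenusDeepSupplyAtTwoNegDiscNarrow` (stmt-23491) BY NAME ⟸ GZ ∧ Mod ∧ Par ∧ Conv ∧ Conv′ ∧ K1Neg ∧ the four WALL
rows ∧ U₂ ∧ Q2 ∧ GZK ∧ L ∧ Milne — WITHOUT K4Neg.**  Per curve: if `#Sel₂(E) = 4` and every level-4 phantom is Selmer, frame at an (α)-prime
(gk2-p3 `exists_alive_primeFrame_of_phantom_selmer` + the stub-A‴ twin bookkeeping) and run the (α) road; otherwise frame by stub A‴ and run K₁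
(`#Sel₂ = 1`) or the bit-TRUE road (`#Sel₂ = 4`, §1).  CONDITIONAL on the fourteen displayed hypotheses (OPEN route items and PRINT items, by
name); BSD is NOT proved; the crux is NOT closed by this; K4Neg is NOT proved (its (β)-frames are simply never chosen).
[cite: GrossZagier1986, Thm. I.6.3] [cite: MazurRubin2010, Prop. 3.3, Cor. 3.4 (i)] [cite: LawsonWuthrich2016, §3, §7.1]
[cite: McCallumLMS1991, §5 Thm. 5.4] [cite: GrossLMS1991, §4 (4.1), §11] -/
theorem genusDeepSupplyAtTwoNegDiscNarrow_of_K1Neg_of_wallRows_U2 (hGZ : GrossZagierAllLevels) (hmod : ModularityExistsNewform)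
    (hpar : TwoParityDD) (hconv : RankOneTwoConverse) (hconv' : RankOneTwoConverseOffSemistableAtTwo) (hK1 : K1Neg)
    (hOrd : GoodOrdinaryRankZeroAtTwo) (hMult : MultiplicativeRankZeroAtTwo) (hSS : SupersingularRankZeroAtTwo) (hAdd : AdditiveRankZeroAtTwo)
    (hTw : MinimalTwinBSDTwo) (hQ2 : KolyvaginRelationAtTwo) (hGZK : MultPublishedInputsAtTwo) (hL : EntireLFunctionRat) (hMi : MilneAnyModel) :
    GenusDeepSupplyAtTwoNegDiscNarrow := by
  intro W _ _ _ hcm hr0 hρ hT hneg hopt h14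
  obtain ⟨Dt, hoptDt, hc⟩ := hopt
  -- the rank-one `2`-converse of the twin, from the two declared converse items
  have hcv : ∀ (V : WeierstrassCurve ℚ) [V.IsElliptic] [V.IsGloballyMinimal],
      ¬ V.HasCM → V.selmerCorank 2 = 1 → V.analyticRank = 1 := fun V _ _ hV hco ↦ by
    by_cases h : (Rank1Residual.GoodOrd V 2 ∨ Rank1Residual.Mult V 2)
    · exact hconv V hV h hco
    · exact hconv' V hV h hco
  by_cases hA : Nat.card (W.selmerGroup 2) = 4 ∧
      ∀ ξ : galH1Torsion W (2 : ℤ), ξ ≠ 0 → (∀ h ∈ torsionFixing W (4 : ℤ), h1Eval W (2 : ℤ) ξ h = 0) → ξ ∈ W.selmerGroup 2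
  · -- ### the phantom cell: frame at an (α)-prime (gk2-p3's unconditional supply)
    obtain ⟨h4, hcell⟩ := hA
    obtain ⟨c₀, hc₀⟩ := exists_isComplexConjugation (Rat.castHom ℝ)
    obtain ⟨ℓ, hℓF, -, -, -, K, iF, iN, hIQ, hdK, hodd, h3, hHe, hsq1, hsq2, h2K, ⟨Wd, iE, iM, hWd, hSelWd⟩, ξ, hξ0, hξ4, v, 𝔓₀, F, hv,
      h𝔓₀, hF, -, hF2, hval⟩ := PhantomDescentBit.exists_alive_primeFrame_of_phantom_selmer W hneg hρ h4 hcell hc₀ 0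
    have hℓ : ℓ.Prime := hℓF.out
    -- the twin: genus budget one bit, non-CM, analytic rank one (stub-A‴ bookkeeping)
    have hprime : (discr K).natAbs.Prime := by
      rw [hdK, Int.natAbs_neg, Int.natAbs_natCast]
      exact hℓ
    obtain ⟨Cd, hCd⟩ := hWd
    have hB : padicValNat 2 Wd.tamagawaProduct = 1 :=
      GenusExact.PlusDescent.padicValNat_two_tamagawaProduct_twin_eq_one_of_prime W hIQ hodd hHe hT hneg hprime Cd hCd
    have hdQ : (discr K : ℚ) ≠ 0 := by exact_mod_cast NumberField.discr_ne_zero K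
    have hcmd : ¬ Wd.HasCM := twin_not_hasCM W hcm hdQ Wd ⟨Cd, hCd⟩
    have htors := natCard_twoTorsion_twin_eq_one W (hρ 1 one_pos) hdQ Wd ⟨Cd, hCd⟩
    have hw := rootNumber_twin_eq_neg_one hmod W hr0 K hIQ hHe Wd ⟨Cd, hCd⟩
    have hco := selmerCorank_two_eq_one_of_card_selmerGroup_two Wd htors hSelWd (odd_selmerCorank_two_of_p_parity Wd (hpar Wd) hw)
    have hrd : Wd.analyticRank = 1 := hcv Wd hcmd hco
    exact genusDeepSupply_conclusion_of_frame hGZ W hcm hr0 Dt hoptDt hc K hIQ hodd h3 hHe hsq1 hsq2 Wd ⟨Cd, hCd⟩ hrd hSelWd hB.le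
      (fun β ι d₁ hy M₀ hdiv hndiv hM₀ ↦
        GenusExact.PlusDescent.kFourNeg_conclusion_of_wallRows_U2_of_alive hOrd hMult hSS hAdd hTw hQ2 hGZ hGZK hL hMi W hcm hr0 hρ hT
          hneg h4 K hIQ hodd h3 hHe hsq1 hsq2 ℓ hℓ hdK h2K Dt hoptDt hc β ι d₁ hy M₀ hdiv hndiv hM₀ Wd ⟨Cd, hCd⟩ hrd hSelWd hB.le hξ0
          hξ4 hv h𝔓₀ hF hF2 hval)
  · -- ### every other curve: the standard prime frame of stub A‴
    obtain ⟨K, iF, iN, hIQ, hodd, h3, hHe, hsq1, hsq2, ⟨ℓ₀, hℓ₀, hdK⟩, h2K, Wd, iE, iM, hWd, hrd, hSel, hDEF⟩ :=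
      stubA_prime_of_items hmod hpar hconv hconv' W hcm hr0 hρ hT hneg h14
    refine genusDeepSupply_conclusion_of_frame hGZ W hcm hr0 Dt hoptDt hc K hIQ hodd h3 hHe hsq1 hsq2 Wd hWd hrd hSel hDEF
      (fun β ι d₁ hy M₀ hdiv hndiv hM₀ ↦ ?_)
    rcases h14 with h1 | h4
    · -- the `#Sel₂(E) = 1` cell: K₁ by name (positive depth is absurd)
      exact (hK1 W hcm hr0 hρ hT hneg h1 K hIQ hodd h3 hHe hsq1 hsq2 Dt hoptDt hc β ι d₁ hy M₀ hdiv hndiv hM₀ Wd hWd hrd hSel hDEF).elim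
    · -- the bit-TRUE `#Sel₂(E) = 4` cell: some phantom is not Selmer, hence none is (§1), hence (NPh_K) and the LEAD road
      have hex : ∃ ξ₀ : galH1Torsion W (2 : ℤ), ξ₀ ≠ 0 ∧ (∀ h ∈ torsionFixing W (4 : ℤ), h1Eval W (2 : ℤ) ξ₀ h = 0) ∧
          ξ₀ ∉ W.selmerGroup 2 := by
        by_contra hne
        push Not at hne
        exact hA ⟨h4, fun ξ hξ0 hξ4 ↦ hne ξ hξ0 hξ4⟩
      obtain ⟨ξ₀, hξ0, hξ4, hξS⟩ := hex
      have hbit := forall_phantom_notMem_selmerGroup_of_exists W hρ K hIQ hodd hsq1 hsq2 hξ0 hξ4 hξS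
      exact GenusExact.PlusDescent.kFourNeg_conclusion_of_wallRows_U2_of_forall_phantom_notMem_selmerGroup hOrd hMult hSS hAdd hTw hQ2 hGZ
        hGZK hL hMi W hcm hr0 hρ hT hneg h4 K hIQ hodd h3 hHe hsq1 hsq2 ℓ₀ hℓ₀ hdK h2K Dt hoptDt hc β ι d₁ hy M₀ hdiv hndiv hM₀ Wd hWd hrd
        hSel hDEF hbit

end Summit.BirchSwinnertonDyer.BirchSwinnertonDyer.Theorems.GenusSupplyNarrow.PrimeFrame

end
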